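import Summits.CriticalPhenomena.PercolationContinuityZ3.Theorems.PercExchangeRateTransportSubcritExchangeUniformityStubSlopePositiveOnCurve
import HarnessLib

/-!
# Stub `RussoPositivity` of the crux `SupercritExchangeUniformity` (K⁺), line
# `local_exchange_homogeneity` (stmt-CriticalPhenomena-16061): a uniform Russo-positivity collar
# above the critical curve

This file proves the REGISTERED stub verbatim (regime split
`OffWindowLimit ∧ LimitFieldRegular ∧ WindowFlatness ∧ RussoPositivity` of the crux K⁺): for the
label-coupled anisotropic bond family on `ℤ²×ℤ` (route `let` preamble `μ, vert, cfg, Θ, θ, pc`),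
for every compact sub-arc `[lo,hi] ⊂ (0,1)` there is `ε > 0` such that for all `n ≥ 1`,
`t ∈ [lo,hi]` and `p_c(t) ≤ p ≤ p_c(t) + ε`: `0 < deriv (fun q => Θ n q t) p`.

Composition (the bookkeeping of the lead's `derivativeFacts_of_stubs`, steps `hpc_le`/`hsq`):

* a subcritical-free density `q₀ ∈ [0,1)` with `θ(q₀,·) > 0` (`exists_density_thetaPerc_pos`,
  sibling crux K⁻), whence `p_c(t) ≤ q₀` by `csInf_le` (the threshold set is bounded below by `0`
  and contains `q₀`); the collar width is `ε := (1 - q₀)/2`;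
* the critical curve lies in the open square, `0 < p_c(t) < 1` for `t ∈ (0,1)` (`pc_mem_Ioo`);
* Russo positivity on the open square (`thetaBox_deriv_p_pos`), applied at
  `(p,t) ∈ (0,1)²`: `0 < p_c(t) ≤ p ≤ q₀ + (1-q₀)/2 < 1`.

The theorem header is one long line: the gate matches registered stub signatures against the
verbatim header text (`;`-separated `let`s).
-/

noncomputable section

open MeasureTheory
open Literature.Probability.Percolation Literature.Probability.LatticeModels
open Summit.CriticalPhenomena.PercolationContinuityZ3.Theorems.SubcritExchangeUniformity
  (exists_density_thetaPerc_pos pc_mem_Ioo thetaBox_deriv_p_pos)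

namespace Summit.CriticalPhenomena.PercolationContinuityZ3.Theorems.SupercritExchangeUniformity

/-- **STUB `RussoPositivity`** (regime-split piece of the crux K⁺ `SupercritExchangeUniformity`).
For every compact sub-arc `[lo,hi] ⊂ (0,1)` there is a collar width `ε > 0` (namely
`(1 - q₀)/2` for the density `q₀` of `exists_density_thetaPerc_pos`) such that for all `n ≥ 1`,
`t ∈ [lo,hi]` and `p_c(t) ≤ p ≤ p_c(t) + ε`: `0 < ∂_pΘ_n(p,t)`.
Proof: `p_c(t) ≤ q₀` (`csInf_le`), `0 < p_c(t)` (`pc_mem_Ioo`), so `(p,t) ∈ (0,1)²`, and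
`thetaBox_deriv_p_pos` (Russo positivity on the open square) closes it.
[Grimmett1999 §2.4 Thm. (2.25); Russo1981 §4 Lemma 3] -/
theorem RussoPositivity : let μ := Literature.Probability.Percolation.labelMeasure (Literature.Probability.LatticeModels.Site 3); let vert : Sym2 (Literature.Probability.LatticeModels.Site 3) → Prop := fun e => ∃ x : Literature.Probability.LatticeModels.Site 3, e = s(x, x + Pi.single (2 : Fin 3) 1); let cfg : ℝ → ℝ → (Sym2 (Literature.Probability.LatticeModels.Site 3) → ℝ) → Set (Sym2 (Literature.Probability.LatticeModels.Site 3)) := fun p t U => {e | e ∈ (Literature.Probability.LatticeModels.zdGraph 3).edgeSet ∧ ((vert e ∧ U e ≤ t) ∨ (¬ vert e ∧ U e ≤ p))}; let Θ : ℕ → ℝ → ℝ → ℝ := fun n p t => μ.real {U | cfg p t U ∈ Literature.Probability.Percolation.siteToBoundary 3 n}; let θ : ℝ → ℝ → ℝ := fun p t => μ.real {U | cfg p t U ∈ Literature.Probability.Percolation.percolatesAt (0 : Literature.Probability.LatticeModels.Site 3)}; let pc : ℝ → ℝ := fun t => sInf ({p : ℝ | 0 ≤ p ∧ p ≤ 1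 ∧ 0 < θ p t} ∪ {1}); ∀ lo hi : ℝ, 0 < lo → lo < hi → hi < 1 → ∃ ε > (0 : ℝ), ∀ n : ℕ, 1 ≤ n → ∀ t ∈ Set.Icc lo hi, ∀ p : ℝ, pc t ≤ p → p ≤ pc t + ε → 0 < deriv (fun q => Θ n q t) p := by
  intro μ vert cfg Θ θ pc lo hi hlo _ hhi
  obtain ⟨q₀, hq₀, hq₁, hθq⟩ := exists_density_thetaPerc_pos
  -- the threshold set is bounded below by `0` and contains `q₀`, so `pc t ≤ q₀`
  have hpc_le : ∀ t, pc t ≤ q₀ := fun t => by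
    refine csInf_le ⟨0, ?_⟩ (Or.inl ⟨hq₀, hq₁.le, hθq t⟩)
    rintro p (⟨hp, -⟩ | hp)
    · exact hp
    · rw [Set.mem_singleton_iff] at hp; rw [hp]; exact zero_le_one
  have h8 := thetaBox_deriv_p_pos
  refine ⟨(1 - q₀) / 2, by linarith, ?_⟩
  intro n hn t ht p hp1 hp2
  have ht' : t ∈ Set.Ioo (0 : ℝ) 1 := ⟨hlo.trans_le ht.1, ht.2.trans_lt hhi⟩
  have h0 : 0 < pc t := (pc_mem_Ioo t ht').1
  have h1 := hpc_le t
  have hp : p ∈ Set.Ioo (0 : ℝ) 1 := ⟨h0.trans_le hp1, by linarith⟩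
  exact h8 n hn p hp t ht'

end Summit.CriticalPhenomena.PercolationContinuityZ3.Theorems.SupercritExchangeUniformity

end
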